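import Mathlib
import Literature.Computability.AlgebraicComplexity.PermanentBooleanSum
import Summits.ValiantsHypothesis.ValiantsHypothesis.Theorems.BarrierLeverPartitionMinorsHitByVPHiddenStatesSecondShellNestedRows
import Summits.ValiantsHypothesis.ValiantsHypothesis.Theorems.BarrierLeverPartitionMinorsHitByVPHiddenStatesSecondShellPrescribed
import Summits.ValiantsHypothesis.ValiantsHypothesis.Theorems.BarrierLeverPartitionMinorsHitByVPHiddenStatesSecondShellCrossTemplate
import Summits.ValiantsHypothesis.ValiantsHypothesis.Theorems.BarrierLeverPartitionMinorsHitByVPHiddenStatesSecondShellChainFour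
import Summits.ValiantsHypothesis.ValiantsHypothesis.Theorems.BarrierLeverPartitionMinorsHitByVPHiddenStatesSecondShellPathReads

/-!
# Route BarrierLever — item `PartitionMinorsHitByVP` (stmt-ValiantsHypothesis-19717), line `hidden-states`:
# ★★ THE PARALLEL NESTED CELL WITH THE EXTRA NODE INERT IN THE START ROW (`m ∈ A₁ ∩ C₁`; every `t, h`)

Helper file (`--supports stmt-ValiantsHypothesis-19717`; cell valiant-natproofs, 𝒟-side door (c), registered line
`Cruxes/PartitionMinorsHitByVP/Lines/hidden_states.lean` v8; prover seat val-np-p6 gen 18).  Closes NO item; definition-free.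

The companion of `…SecondShellParallelNested` (`m ∉ A₁`) for `m ∈ A₁ ∩ C₁`: `Y₁ = C₁∖A₁ = {a,b,c}`, `Y₂ = C₂∖A₂ = {a,b,c,m}`.
Now `m` lies IN the start row `C₁` of the cross minor `D_{B−A₂+C₁}` and is the top of path 2 = (a < b < c < m), so the start
row has FOUR movers forming the chain `m → c → b → a` with inert part `Z₁' = (A₁ ∩ C₁) ∖ {m}` (budget three): `a`-exits
`x₀, x₁, f₀, f₁`, one `b`-exit `f` (the level-1 attachment of path 2), no `c`- or `m`-exits.  By the FOUR-MOVER CHAIN LEMMA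
(`…SecondShellChainFour.det_eq_zero_of_chain₄`) the only pure rows `Z₁' ∪ {d,d',d''}` that must be present have `β_d ≠ 0`,
i.e. `d = f` a READ exit; choosing `f ∈ (A₂∖C₂) ∩ (A₁∩C₁)` whenever that set is nonempty makes `f` inert (no such row is asked
for), and otherwise `Z₁' ∪ {f, d', d''} = A₂` forces `{d', d''} = {f₀, f₁}`, `A₂ = Z₁' ∪ (A₂∖C₂)` and then `C₂ ⊆ C₁`, i.e.
`C₁ = C₂` — excluded.  Every other required row contains a mover (`∉ A₂`) or is smaller than `A₂`.  ★★
`exists_table_secondShell_parallelNestedZ`.  EXACT t = 4 CENSUS (kit j322364): shapes ((3,4),3,1,2,1) (30 240 families) and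
((3,4),3,0,2,1) (15 120) of B₄(9).

HONEST LABEL: conjecture-column cell (second shell, every `t, h`); 19717 stays OPEN; nothing on crux 14610 or VP ≠ VNP.
-/

set_option linter.dupNamespace false

namespace Summit.ValiantsHypothesis.ValiantsHypothesis.Theorems.BarrierLever.HiddenStates

open Finset

noncomputable section

namespace SecondShell

open PathTable

/-! ## ★★ The parallel nested cell, `m ∈ A₁ ∩ C₁` -/

set_option maxHeartbeats 400000 in
/-- ★★ **SECOND SHELL, PARALLEL NESTED CLASSES WITH `m ∈ A₁ ∩ C₁`, EVERY `t, h`.**  `C₁∖A₁ = {a,b,c}`, `C₂∖A₂ = {a,b,c,m}`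
with `m ∈ A₁ ∩ C₁`: the class is served by a two-parameter path table. -/
theorem exists_table_secondShell_parallelNestedZ (h t : ℕ) (A₁ A₂ C₁ C₂ : Finset (Fin h))
    (hA₁ : A₁.card = t) (hA₂ : A₂.card = t) (hC₁ : C₁.card = t + 1) (hC₂ : C₂.card = t + 1)
    (h₁ : ¬ A₁ ⊆ C₁) (h₂ : ¬ A₂ ⊆ C₂) (hA : A₁ ≠ A₂) (hC : C₁ ≠ C₂)
    {ya yb yc ym : Fin h}
    (hY₁ : C₁ \ A₁ = {ya, yb, yc}) (hab : ya ≠ yb) (hac : ya ≠ yc) (hbc : yb ≠ yc)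
    (hY₂ : C₂ \ A₂ = {ya, yb, yc, ym}) (hma : ym ≠ ya) (hmb : ym ≠ yb) (hmc : ym ≠ yc) (hmA : ym ∈ A₁) (hmC : ym ∈ C₁)
    {r : ℕ} (u cols : Fin r → Finset (Fin h)) (hu : Function.Injective u)
    (hU : ∀ i, ((u i).card ≤ t ∧ u i ≠ A₁ ∧ u i ≠ A₂) ∨ u i = C₁ ∨ u i = C₂)
    (hcols : ∀ J : Finset (Fin h), J.card ≤ t → ∃ kk, cols kk = J) :
    ∃ tx : Option (Fin h) → Fin h → ℂ,
      (Matrix.of fun i kk : Fin r => ∏ a ∈ u i, (tx none a + ∑ q ∈ cols kk, tx (some q) a)).det ≠ 0 := by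
  classical
  obtain ⟨k₁, j₁, j₁', hk₁, hkj₁, a1, a2, a3, a4⟩ := swap_sizes A₁ C₁ hA₁ hC₁ h₁
  obtain ⟨k₂, j₂, j₂', hk₂, hkj₂, b1, b2, b3, b4⟩ := swap_sizes A₂ C₂ hA₂ hC₂ h₂
  -- sizes: `k₁ = 2`, `k₂ = 3`
  have hY₁c : (C₁ \ A₁).card = 3 := by
    rw [hY₁, Finset.card_insert_of_notMem (by simp [hab, hac]), Finset.card_pair hbc]
  have hY₂c : (C₂ \ A₂).card = 4 := by
    rw [hY₂, Finset.card_insert_of_notMem (by simp [hab, hac, hma.symm]),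
      Finset.card_insert_of_notMem (by simp [hbc, hmb.symm]), Finset.card_pair hmc.symm]
  obtain rfl : k₁ = 2 := by omega
  obtain rfl : k₂ = 3 := by omega
  -- membership facts
  have hya₁ : ya ∈ C₁ \ A₁ := by rw [hY₁]; simp
  have hyb₁ : yb ∈ C₁ \ A₁ := by rw [hY₁]; simp
  have hyc₁ : yc ∈ C₁ \ A₁ := by rw [hY₁]; simp
  have hya₂ : ya ∈ C₂ \ A₂ := by rw [hY₂]; simp
  have hyb₂ : yb ∈ C₂ \ A₂ := by rw [hY₂]; simp
  have hyc₂ : yc ∈ C₂ \ A₂ := by rw [hY₂]; simp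
  have hym₂ : ym ∈ C₂ \ A₂ := by rw [hY₂]; simp
  obtain ⟨⟨hyaC₁, hyaA₁⟩, ⟨hybC₁, hybA₁⟩, ⟨hycC₁, hycA₁⟩⟩ :=
    And.intro (Finset.mem_sdiff.1 hya₁) (And.intro (Finset.mem_sdiff.1 hyb₁) (Finset.mem_sdiff.1 hyc₁))
  obtain ⟨⟨hyaC₂, hyaA₂⟩, ⟨hybC₂, hybA₂⟩, ⟨hycC₂, hycA₂⟩, ⟨hymC₂, hymA₂⟩⟩ :=
    And.intro (Finset.mem_sdiff.1 hya₂) (And.intro (Finset.mem_sdiff.1 hyb₂)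
      (And.intro (Finset.mem_sdiff.1 hyc₂) (Finset.mem_sdiff.1 hym₂)))
  -- the attachments of path 1
  obtain ⟨x₀, x₁, hx, hX₁⟩ := Finset.card_eq_two.1 a2
  have hx₀ : x₀ ∈ A₁ \ C₁ := by rw [hX₁]; simp
  have hx₁ : x₁ ∈ A₁ \ C₁ := by rw [hX₁]; simp
  -- the attachments of path 2, the level-1 attachment `f` INSIDE `A₁ ∩ C₁` whenever possible
  obtain ⟨f₀, f₁, f, hf₀₁, hf₀, hf₁, hX₂, hfZ⟩ : ∃ f₀ f₁ f : Fin h, f₀ ≠ f₁ ∧ f₀ ≠ f ∧ f₁ ≠ f ∧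
      A₂ \ C₂ = {f₀, f₁, f} ∧ (f ∉ A₁ ∩ C₁ → ∀ g ∈ A₂ \ C₂, g ∉ A₁ ∩ C₁) := by
    by_cases hex : ∃ g ∈ A₂ \ C₂, g ∈ A₁ ∩ C₁
    · obtain ⟨f, hfX, hfZ⟩ := hex
      have hc : ((A₂ \ C₂).erase f).card = 2 := by rw [Finset.card_erase_of_mem hfX, b2]
      obtain ⟨g₀, g₁, h01, hX⟩ := Finset.card_eq_two.1 hc
      have hg₀ : g₀ ∈ (A₂ \ C₂).erase f := by rw [hX]; simp
      have hg₁ : g₁ ∈ (A₂ \ C₂).erase f := by rw [hX]; simp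
      refine ⟨g₀, g₁, f, h01, (Finset.mem_erase.1 hg₀).1, (Finset.mem_erase.1 hg₁).1, ?_, fun h' => absurd hfZ h'⟩
      rw [← Finset.insert_erase hfX, hX]
      ext q; simp only [Finset.mem_insert, Finset.mem_singleton]; tauto
    · push Not at hex
      obtain ⟨g₀, g₁, g₂, h01, h02, h12, hX⟩ := Finset.card_eq_three.1 b2
      exact ⟨g₀, g₁, g₂, h01, h02, h12, hX, fun _ => hex⟩
  have hf₀X : f₀ ∈ A₂ \ C₂ := by rw [hX₂]; simp
  have hf₁X : f₁ ∈ A₂ \ C₂ := by rw [hX₂]; simp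
  have hfX : f ∈ A₂ \ C₂ := by rw [hX₂]; simp
  -- fully prescribed transports: path 1 = (ya < yb < yc), x₀, x₁ at ya; path 2 = (ya < yb < yc < ym), f₀, f₁ at ya, f at yb
  have hinjY₁ : Function.Injective ![ya, yb, yc] := injective_vec3 hab hac hbc
  have hinjX₁ : Function.Injective ![x₀, x₁] := injective_vec2 hx
  have hinjY₂ : Function.Injective ![ya, yb, yc, ym] := Literature.Computability.AlgebraicComplexity.injective_vec4 hab hac hma.symm hbc hmb.symm hmc.symm
  have hinjX₂ : Function.Injective ![f₀, f₁, f] := injective_vec3 hf₀₁ hf₀ hf₁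
  have hmemY₁ : ∀ p, ![ya, yb, yc] p ∈ C₁ \ A₁ := by
    intro p; fin_cases p
    · exact hya₁
    · exact hyb₁
    · exact hyc₁
  have hmemX₁ : ∀ i, ![x₀, x₁] i ∈ A₁ \ C₁ := by
    intro i; fin_cases i
    · exact hx₀
    · exact hx₁
  have hmemY₂ : ∀ p, ![ya, yb, yc, ym] p ∈ C₂ \ A₂ := by
    intro p; fin_cases p
    · exact hya₂
    · exact hyb₂
    · exact hyc₂
    · exact hym₂
  have hmemX₂ : ∀ i, ![f₀, f₁, f] i ∈ A₂ \ C₂ := by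
    intro i; fin_cases i
    · exact hf₀X
    · exact hf₁X
    · exact hfX
  obtain ⟨e₁, m1, m2, m3, m4, hpy₁, hpx₁⟩ := exists_equiv_prescribed A₁ C₁ a1 a2 a3 a4 _ hinjY₁ hmemY₁ _ hinjX₁ hmemX₁
  obtain ⟨e₂, n1, n2, n3, n4, hpy₂, hpx₂⟩ := exists_equiv_prescribed A₂ C₂ b1 b2 b3 b4 _ hinjY₂ hmemY₂ _ hinjX₂ hmemX₂
  have he₁a : e₁ (Sum.inl (Sum.inl 0)) = ya := by rw [hpy₁]; rfl
  have he₁b : e₁ (Sum.inl (Sum.inl 1)) = yb := by rw [hpy₁]; rfl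
  have he₁c : e₁ (Sum.inl (Sum.inl 2)) = yc := by rw [hpy₁]; rfl
  have he₁x₀ : e₁ (Sum.inl (Sum.inr 0)) = x₀ := by rw [hpx₁]; rfl
  have he₁x₁ : e₁ (Sum.inl (Sum.inr 1)) = x₁ := by rw [hpx₁]; rfl
  have he₂a : e₂ (Sum.inl (Sum.inl 0)) = ya := by rw [hpy₂]; rfl
  have he₂b : e₂ (Sum.inl (Sum.inl 1)) = yb := by rw [hpy₂]; rfl
  have he₂c : e₂ (Sum.inl (Sum.inl 2)) = yc := by rw [hpy₂]; rfl
  have he₂f₀ : e₂ (Sum.inl (Sum.inr 0)) = f₀ := by rw [hpx₂]; rfl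
  have he₂f₁ : e₂ (Sum.inl (Sum.inr 1)) = f₁ := by rw [hpx₂]; rfl
  have he₂f : e₂ (Sum.inl (Sum.inr 2)) = f := by rw [hpx₂]; rfl
  have he₂m : e₂ (Sum.inl (Sum.inl 3)) = ym := by rw [hpy₂]; rfl
  refine exists_table_secondShell_of_cross h t A₁ A₂ C₁ C₂ hA₁ hA₂ hC₁ hC₂ hA hC hk₁ hkj₁ hk₂ hkj₂ e₁ m1 m2 m3 m4
    e₂ n1 n2 n3 n4 u cols hu hU hcols (Or.inr ?_)
  intro rows i₀ hrow₀ key hcolcard ε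
  -- table facts (who reads whom, zeros between path nodes, unit rows of the attachments)
  have R₁ := fun d => path₂_reads e₁ he₁a he₁b he₁c he₁x₀ he₁x₁ d
  have R₂ := fun d => path₃_reads e₂ he₂a he₂b he₂c he₂m he₂f₀ he₂f₁ he₂f d
  obtain ⟨v₁ab, v₁ac, v₁bc, v₁ca⟩ := path₂_zeros e₁ he₁a he₁b he₁c
  obtain ⟨v₂ab, v₂ac, v₂am, v₂bc, v₂bm, v₂ca, v₂cm, v₂ma, v₂mb⟩ := path₃_zeros e₂ he₂a he₂b he₂c he₂m
  have hm₁ : ym ∉ C₁ \ A₁ := fun h' => (Finset.mem_sdiff.1 h').2 hmA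
  have v₁m : ∀ q, swapTable' e₁ ym q = if q = ym then 1 else 0 := row_unit A₁ C₁ e₁ m1 hm₁
  have v₁am : swapTable' e₁ ya ym = 0 := by
    by_contra h'
    rcases (R₁ ym).1 h' hma with h | h
    · exact (Finset.mem_sdiff.1 hx₀).2 (h ▸ hmC)
    · exact (Finset.mem_sdiff.1 hx₁).2 (h ▸ hmC)
  have v₁bm : swapTable' e₁ yb ym = 0 := by by_contra h'; exact hma ((R₁ ym).2.1 h' hmb)
  have v₁cm : swapTable' e₁ yc ym = 0 := by by_contra h'; exact hmb ((R₁ ym).2.2 h' hmc)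
  have hunit : ∀ d, d ∈ A₁ \ C₁ ∨ d ∈ A₂ \ C₂ → ∀ q, swapTable' e₁ d q = (if q = d then 1 else 0) ∧
      swapTable' e₂ d q = (if q = d then 1 else 0) := by
    intro d hd q
    have hd₁ : d ∉ C₁ \ A₁ := by
      rcases hd with hd | hd
      · exact fun h' => (Finset.mem_sdiff.1 h').2 (Finset.mem_sdiff.1 hd).1
      · intro h'
        rw [hY₁] at h'
        simp only [Finset.mem_insert, Finset.mem_singleton] at h'
        rcases h' with rfl | rfl | rfl
        · exact (Finset.mem_sdiff.1 hd).2 hyaC₂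
        · exact (Finset.mem_sdiff.1 hd).2 hybC₂
        · exact (Finset.mem_sdiff.1 hd).2 hycC₂
    have hd₂ : d ∉ C₂ \ A₂ := by
      rcases hd with hd | hd
      · intro h'
        have hdA₁ := (Finset.mem_sdiff.1 hd).1
        rw [hY₂] at h'
        simp only [Finset.mem_insert, Finset.mem_singleton] at h'
        rcases h' with rfl | rfl | rfl | rfl
        · exact hyaA₁ hdA₁
        · exact hybA₁ hdA₁
        · exact hycA₁ hdA₁
        · exact (Finset.mem_sdiff.1 hd).2 hmC
      · exact fun h' => (Finset.mem_sdiff.1 h').2 (Finset.mem_sdiff.1 hd).1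
    exact ⟨row_unit A₁ C₁ e₁ m1 hd₁ q, row_unit A₂ C₂ e₂ n1 hd₂ q⟩
  -- the combined table and what the movers read in it
  set w : Fin h → Fin h → ℂ := tab2 (fun a q => swapTable' e₁ a q - if q = a then 1 else 0)
      (fun a q => swapTable' e₂ a q - if q = a then 1 else 0) ε with hw
  have hwdef : ∀ y q, w y q = (if q = y then 1 else 0) + ε 0 * (swapTable' e₁ y q - if q = y then 1 else 0)
      + ε 1 * (swapTable' e₂ y q - if q = y then 1 else 0) := fun y q => rfl
  have hoff : ∀ y d, d ≠ y → w y d ≠ 0 → swapTable' e₁ y d ≠ 0 ∨ swapTable' e₂ y d ≠ 0 := by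
    intro y d hdy hw0
    by_contra hcon
    push Not at hcon
    apply hw0
    rw [hwdef, hcon.1, hcon.2, if_neg hdy]; ring
  have hreada : ∀ d, d ≠ ya → w ya d ≠ 0 → d = x₀ ∨ d = x₁ ∨ d = f₀ ∨ d = f₁ := by
    intro d hd hw0
    rcases hoff ya d hd hw0 with h' | h'
    · rcases (R₁ d).1 h' hd with h | h
      · exact Or.inl h
      · exact Or.inr (Or.inl h)
    · rcases (R₂ d).1 h' hd with h | h
      · exact Or.inr (Or.inr (Or.inl h))
      · exact Or.inr (Or.inr (Or.inr h))
  have hreadb : ∀ d, d ≠ yb → w yb d ≠ 0 → d = ya ∨ d = f := by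
    intro d hd hw0
    rcases hoff yb d hd hw0 with h' | h'
    · exact Or.inl ((R₁ d).2.1 h' hd)
    · exact (R₂ d).2.1 h' hd
  have hreadc : ∀ d, d ≠ yc → w yc d ≠ 0 → d = yb := by
    intro d hd hw0
    rcases hoff yc d hd hw0 with h' | h'
    · exact (R₁ d).2.2 h' hd
    · exact (R₂ d).2.2.1 h' hd
  have hreadm : ∀ d, d ≠ ym → w ym d ≠ 0 → d = yc := by
    intro d hd hw0
    rcases hoff ym d hd hw0 with h' | h'
    · exfalso; apply h'; rw [v₁m d, if_neg hd]
    · exact (R₂ d).2.2.2 h' hd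
  -- the inert part `Z = (A₁ ∩ C₁) ∖ {m}` of the start row
  obtain ⟨Z, hZdef⟩ : ∃ Z : Finset (Fin h), Z = (A₁ ∩ C₁).erase ym := ⟨_, rfl⟩
  have hmZ₁ : ym ∈ A₁ ∩ C₁ := Finset.mem_inter.2 ⟨hmA, hmC⟩
  have hZsub : Z ⊆ A₁ ∩ C₁ := by rw [hZdef]; exact Finset.erase_subset _ _
  have hZc : Z.card + 3 = t := by rw [hZdef, Finset.card_erase_of_mem hmZ₁, a3]; omega
  have hmZ : ym ∉ Z := by rw [hZdef]; exact Finset.notMem_erase _ _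
  have hZ₁eq : A₁ ∩ C₁ = insert ym Z := by rw [hZdef, Finset.insert_erase hmZ₁]
  have hyZ : ∀ y, y ∉ A₁ → y ∉ Z := fun y hy h' => hy (Finset.mem_inter.1 (hZsub h')).1
  have hM4 : ∀ d, d ∉ ({ya, yb, yc, ym} : Finset (Fin h)) ↔ d ≠ ya ∧ d ≠ yb ∧ d ≠ yc ∧ d ≠ ym := by
    intro d; simp only [Finset.mem_insert, Finset.mem_singleton, not_or]
  -- every read exit is one of the five attachments
  have hexit : ∀ d, d ≠ ya → d ≠ yb → d ≠ yc → d ≠ ym → (w ya d ≠ 0 ∨ w yb d ≠ 0 ∨ w yc d ≠ 0 ∨ w ym d ≠ 0) →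
      d ∈ A₁ \ C₁ ∨ d ∈ A₂ \ C₂ := by
    intro d hda hdb hdc hdm hread
    rcases hread with h' | h' | h' | h'
    · rcases hreada d hda h' with rfl | rfl | rfl | rfl
      · exact Or.inl hx₀
      · exact Or.inl hx₁
      · exact Or.inr hf₀X
      · exact Or.inr hf₁X
    · rcases hreadb d hdb h' with h | rfl
      · exact absurd h hda
      · exact Or.inr hfX
    · exact absurd (hreadc d hdc h') hdb
    · exact absurd (hreadm d hdm h') hdc
  -- rows through a mover, and small rows, are present
  have hmov : ∀ S : Finset (Fin h), S.card ≤ t → (∃ y ∈ S, y ∉ A₂) → ∃ i, i ≠ i₀ ∧ rows i = S :=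
    fun S hS ⟨y, hyS, hyA⟩ => key S hS fun hSA => hyA (hSA ▸ hyS)
  have hcardT : ∀ T : Finset (Fin h), Disjoint T Z → T.card ≤ 3 → (T ∪ Z).card ≤ t := fun T hT hT3 => by
    rw [Finset.card_union_of_disjoint hT]; omega
  have hdisj3 : ∀ p q s : Fin h, p ∉ Z → q ∉ Z → s ∉ Z → Disjoint ({p, q, s} : Finset (Fin h)) Z := by
    intro p q s hp hq hs
    rw [Finset.disjoint_insert_left, Finset.disjoint_insert_left, Finset.disjoint_singleton_left]; exact ⟨hp, hq, hs⟩
  have hrow3 : ∀ p q s : Fin h, p ∉ A₂ → p ∉ Z → q ∉ Z → s ∉ Z → ∃ i, i ≠ i₀ ∧ rows i = {p, q, s} ∪ Z := by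
    intro p q s hpA hp hq hs
    exact hmov _ (hcardT _ (hdisj3 p q s hp hq hs) Finset.card_le_three) ⟨p, Finset.mem_union_left _ (by simp), hpA⟩
  have haZ := hyZ ya hyaA₁
  have hbZ := hyZ yb hybA₁
  have hcZ := hyZ yc hycA₁
  refine det_eq_zero_of_chain₄ w rows cols i₀ Z hab hac hma.symm hbc hmb.symm hmc.symm haZ hbZ hcZ hmZ
    ?_ ?_ ?_ ?_ ?_ ?_ ?_ ?_ ?_ ?_ ?_ ?_ ?_ ?_ ?_ ?_ ?_ ?_ ?_ ?_ ?_ ?_ ?_ ?_ ?_ ?_ ?_ ?_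
  · -- unit rows on `Z`
    intro z hz q
    obtain ⟨hzA, hzC⟩ := Finset.mem_inter.1 (hZsub hz)
    have hz₁ : z ∉ C₁ \ A₁ := fun h' => (Finset.mem_sdiff.1 h').2 hzA
    have hz₂ : z ∉ C₂ \ A₂ := by
      intro h'
      rw [hY₂] at h'
      simp only [Finset.mem_insert, Finset.mem_singleton] at h'
      rcases h' with rfl | rfl | rfl | rfl
      · exact hyaA₁ hzA
      · exact hybA₁ hzA
      · exact hycA₁ hzA
      · exact hmZ hz
    rw [hwdef, row_unit A₁ C₁ e₁ m1 hz₁ q, row_unit A₂ C₂ e₂ n1 hz₂ q]; ring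
  · rw [hwdef, swapTable'_self, swapTable'_self, if_pos rfl]; ring
  · rw [hwdef, v₁ab, v₂ab, if_neg hab.symm]; ring
  · rw [hwdef, v₁ac, v₂ac, if_neg hac.symm]; ring
  · rw [hwdef, v₁am, v₂am, if_neg hma]; ring
  · rw [hwdef, swapTable'_self, swapTable'_self, if_pos rfl]; ring
  · rw [hwdef, v₁bc, v₂bc, if_neg hbc.symm]; ring
  · rw [hwdef, v₁bm, v₂bm, if_neg hmb]; ring
  · rw [hwdef, swapTable'_self, swapTable'_self, if_pos rfl]; ring
  · rw [hwdef, v₁ca, v₂ca, if_neg hac]; ring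
  · rw [hwdef, v₁cm, v₂cm, if_neg hmc]; ring
  · rw [hwdef, swapTable'_self, swapTable'_self, if_pos rfl]; ring
  · rw [hwdef, v₁m ya, v₂ma, if_neg hma.symm]; ring
  · rw [hwdef, v₁m yb, v₂mb, if_neg hmb.symm]; ring
  · -- read exits are attachments, hence unit rows
    intro d _ hdM hread q
    obtain ⟨hda, hdb, hdc, hdm⟩ := (hM4 d).1 hdM
    have hd := hexit d hda hdb hdc hdm hread
    rw [hwdef, (hunit d hd q).1, (hunit d hd q).2]; ring
  · rw [hrow₀, ← hZ₁eq]; exact eq_insert₃_inter hY₁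
  · intro kk; rw [hZc]; exact hcolcard kk
  · -- small rows and mover rows
    intro T hTZ hT _
    rcases hT with hT2 | ⟨hTM, hT3⟩
    · refine key _ (hcardT T hTZ (by omega)) fun hEq => ?_
      have h1 := Finset.card_union_of_disjoint hTZ; rw [hEq, hA₂] at h1; omega
    · by_cases hT0 : T = ∅
      · refine key _ (hcardT T hTZ hT3) fun hEq => ?_
        have h1 := Finset.card_union_of_disjoint hTZ; rw [hEq, hA₂, hT0, Finset.card_empty] at h1; omega
      · obtain ⟨y, hy⟩ := Finset.nonempty_iff_ne_empty.2 hT0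
        refine hmov _ (hcardT T hTZ hT3) ⟨y, Finset.mem_union_left _ hy, ?_⟩
        have hyM := hTM hy
        simp only [Finset.mem_insert, Finset.mem_singleton] at hyM
        rcases hyM with rfl | rfl | rfl | rfl
        · exact hyaA₂
        · exact hybA₂
        · exact hycA₂
        · exact hymA₂
  · intro d hdZ _ _; exact hrow3 ya yb d hyaA₂ haZ hbZ hdZ
  · intro d hdZ _ _ _; exact hrow3 ya yc d hyaA₂ haZ hcZ hdZ
  · intro d hdZ _ _; exact hrow3 ya ym d hyaA₂ haZ hmZ hdZ
  · intro d hdZ _ _ _; exact hrow3 yb yc d hybA₂ hbZ hcZ hdZ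
  · intro d hdZ _ _ _; exact hrow3 yb ym d hybA₂ hbZ hmZ hdZ
  · intro d hdZ _ _; exact hrow3 yc ym d hycA₂ hcZ hmZ hdZ
  · intro d d' _ hdZ hd'Z _ _ _ _; exact hrow3 ya d d' hyaA₂ haZ hdZ hd'Z
  · intro d d' _ hdZ hd'Z _ _ _ _; exact hrow3 yb d d' hybA₂ hbZ hdZ hd'Z
  · intro d d' _ hdZ hd'Z _ _ _ _; exact hrow3 ym d d' hymA₂ hmZ hdZ hd'Z
  · -- ★ the pure triples: `d` is read by `b`, so `d = f` is a free exit; then `Z ∪ {f, d', d''} = A₂` would force `C₁ = C₂`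
    intro d d' d'' _ _ _ hdZ _ _ hdM hd'M hd''M hbd had' had''
    obtain ⟨hda, hdb, -, -⟩ := (hM4 d).1 hdM
    obtain ⟨hd'a, -, -, -⟩ := (hM4 d').1 hd'M
    obtain ⟨hd''a, -, -, -⟩ := (hM4 d'').1 hd''M
    refine key _ (hcardT _ (hdisj3 d d' d'' hdZ ‹d' ∉ Z› ‹d'' ∉ Z›) Finset.card_le_three) fun hEq => ?_
    have hdf : d = f := by
      rcases hreadb d hdb hbd with h' | h'
      · exact absurd h' hda
      · exact h'
    have hfZ₁ : f ∉ A₁ ∩ C₁ := by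
      intro h'
      rw [hZ₁eq, Finset.mem_insert] at h'
      rcases h' with h' | h'
      · exact (Finset.mem_sdiff.1 hfX).2 (h' ▸ hymC₂)
      · exact hdZ (hdf ▸ h')
    have hXZ := hfZ hfZ₁
    -- `f₀, f₁ ∈ A₂ = {d, d', d''} ∪ Z` are neither in `Z` nor equal to `d = f`
    have hfj : ∀ g, g ∈ A₂ \ C₂ → g ≠ f → g = d' ∨ g = d'' := by
      intro g hg hgf
      have hgA : g ∈ ({d, d', d''} : Finset (Fin h)) ∪ Z := by rw [hEq]; exact (Finset.mem_sdiff.1 hg).1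
      rw [Finset.mem_union] at hgA
      rcases hgA with hgT | hgZ
      · simp only [Finset.mem_insert, Finset.mem_singleton] at hgT
        rcases hgT with h' | h' | h'
        · exact absurd (h'.trans hdf) hgf
        · exact Or.inl h'
        · exact Or.inr h'
      · exact absurd (hZsub hgZ) (hXZ g hg)
    have hd'X : d' ∈ A₂ \ C₂ := by
      rcases hfj f₀ hf₀X hf₀ with h0 | h0
      · exact h0 ▸ hf₀X
      · rcases hfj f₁ hf₁X hf₁ with h1 | h1
        · exact h1 ▸ hf₁X
        · exact absurd (h0.trans h1.symm) hf₀₁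
    have hd''X : d'' ∈ A₂ \ C₂ := by
      rcases hfj f₀ hf₀X hf₀ with h0 | h0
      · rcases hfj f₁ hf₁X hf₁ with h1 | h1
        · exact absurd (h0.trans h1.symm) hf₀₁
        · exact h1 ▸ hf₁X
      · exact h0 ▸ hf₀X
    -- hence `C₂ ⊆ C₁`, contradicting `C₁ ≠ C₂`
    have hsub : C₂ ⊆ C₁ := by
      intro x hx
      by_cases hxA : x ∈ A₂
      · have hx' : x ∈ ({d, d', d''} : Finset (Fin h)) ∪ Z := by rw [hEq]; exact hxA
        rw [Finset.mem_union] at hx'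
        rcases hx' with hxT | hxZ
        · exfalso
          simp only [Finset.mem_insert, Finset.mem_singleton] at hxT
          rcases hxT with rfl | rfl | rfl
          · exact (Finset.mem_sdiff.1 hfX).2 (hdf ▸ hx)
          · exact (Finset.mem_sdiff.1 hd'X).2 hx
          · exact (Finset.mem_sdiff.1 hd''X).2 hx
        · exact (Finset.mem_inter.1 (hZsub hxZ)).2
      · have hxY : x ∈ C₂ \ A₂ := Finset.mem_sdiff.2 ⟨hx, hxA⟩
        rw [hY₂] at hxY
        simp only [Finset.mem_insert, Finset.mem_singleton] at hxY
        rcases hxY with rfl | rfl | rfl | rfl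
        · exact hyaC₁
        · exact hybC₁
        · exact hycC₁
        · exact hmC
    exact hC (Finset.eq_of_subset_of_card_le hsub (by rw [hC₁, hC₂])).symm

end SecondShell

end

end Summit.ValiantsHypothesis.ValiantsHypothesis.Theorems.BarrierLever.HiddenStates
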